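import Mathlib
import Literature.Computability.AlgebraicComplexity.OrbitCoordinateRingProofs
import Literature.Computability.AlgebraicComplexity.OrbitClosureProofs
import Literature.Computability.AlgebraicComplexity.MultiplicityObstructionsProofs
import Literature.Computability.AlgebraicComplexity.CoordRepRational
import Literature.Computability.AlgebraicComplexity.GCTObstructions
import Literature.NumberTheory.DiophantineGeometry.GLHighestWeightExistsUniqueProofs
import Literature.NumberTheory.DiophantineGeometry.GLPolynomialRepSemisimpleProofs
import Literature.NumberTheory.DiophantineGeometry.GLHighestWeightMultiplicityProofs
import Literature.NumberTheory.DiophantineGeometry.SchurWeylPlethysmOrbitWeightsProofs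
import HarnessLib

/-!
# Outer separation: non-membership in an orbit closure is witnessed by a highest-weight EQUATION
# (crux `ValuativeGCT.ValuativeFlip`, stmt-ValiantsHypothesis-12624; wall-breaker k13 gen 1 seat 2,
# axis "explicit padded-permanent highest-weight vectors"; helper file `--supports`)

The per-side engines of this axis (explicit / lifted / inherited highest-weight vectors of the padded
permanent) are saturated on INNER shapes; the only tail-relevant objects of the axis are OUTER
highest-weight vectors: `B`-semi-invariants `F ∈ ℂ[Sym^m ℂ^σ]` of some weight `χ` that are EQUATIONS of
`Δ_m(f) = \overline{GL · f}` (`F ∈ I(GL · f)`) and are NOT equations of `Δ_m(g)` (`F ∉ I(GL · g)`,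
equivalently the class of `F` is a non-zero highest-weight vector of `ℂ[Δ_m(g)]`).  This file proves
the structure theorem behind them, for arbitrary forms `f, g` of degree `m` on linearly ordered
variables `σ` (the Borel of `GL σ ℂ` is the upper triangular one of `GLHighestWeight`):

* `os_exists_hwv_mem_not_mem` — in a finite-dimensional rational `GL σ ℂ`-module, if a stable subspace
  `M` is not contained in a stable subspace `N`, some HIGHEST-WEIGHT vector of `M` lies outside `N`
  (complete reducibility + Lie–Kolchin + the modular law);
* `os_exists_hwv_sep` — if some polynomial `Ψ ∈ I(GL · f)` has `Ψ ∉ I(GL · g)`, then some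
  highest-weight vector `F` of `coordRep σ ℂ m` has `F ∈ I(GL · f)`, `F ∉ I(GL · g)` (apply the previous
  lemma inside the finite-dimensional stable truncation `⊕_{d ≤ deg Ψ} ℂ[Sym^m]_d`);
* `os_exists_hwv_sep_of_not_mem_orbitClosure` / `os_not_mem_orbitClosure_of_sep` — hence
  **`g ∉ Δ_m(f)` iff an outer highest-weight vector exists** (some irreducible module of equations of
  `Δ_m(f)` does not vanish on `GL · g`);
* `os_occurs_and_equation` — multiplicity currency: such an `F` of weight `χ` gives
  `1 ≤ mult_χ ℂ[Δ_m(g)]` and `mult_χ ℂ[Δ_m(f)] + 1 ≤ plethysmCoeff χ` (the weight OCCURS on the `g` side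
  and carries an EQUATION on the `f` side);
* `os_lt_iff_finrank_inf_lt`, `os_exists_outer_hwv_of_lt` — a multiplicity flip
  `mult_χ ℂ[Δ(f)] < mult_χ ℂ[Δ(g)]` is exactly `dim (HWV_χ ∩ I(g)) < dim (HWV_χ ∩ I(f))`, so every flip
  contains an outer highest-weight vector, and full-ness of the `g` side (`mult_χ ℂ[Δ(g)] = plethysm`)
  plus ONE equation of `Δ(f)` of weight `χ` is already a flip (`os_lt_of_full_of_equation`).

The padded-permanent / determinant instance in the LOW TAIL `n < m ≤ (n²-1)/2` (Landsberg–Manivel–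
Ressayre, proved in the tree) is in the sibling file `…LowTailOuterHwv.lean`.

Sources: BLMW, SIAM J. Comput. 40 (2011) §4.4, §5 (coordinate rings, `I(Z)_δ ⊆ I(Z₀)_δ`);
Bläser–Ikenmeyer, *Introduction to GCT* (2025) §12.4 (multiplicity obstructions, Cor. 12.6/Prop. 12.7);
Goodman–Wallach GTM 255 §3.2.1, §4.1.6, Thm 11.4.2 (highest-weight vectors, complete reducibility,
Lie–Kolchin); Mulmuley–Sohoni 2001 §4–5.  All representation-theoretic inputs are the tree's
discharged facts (`isSemisimpleRepresentation_of_isRationalRep_holds`,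
`exists_hasHighestWeight_of_finiteDimensional_holds`, `isRationalRep_coordRep`,
`mem_orbitClosure_iff_formCoeff_holds`, `map_highestWeightSpace_eq_of_surjective`).
-/

set_option linter.dupNamespace false

namespace Summit.ValiantsHypothesis.ValiantsHypothesis.Theorems.ValuativeFlip

open MvPolynomial
open scoped BigOperators Matrix
open Literature.NumberTheory.DiophantineGeometry
open Literature.Computability.AlgebraicComplexity

noncomputable section

/-! ## 1. Abstract: a stable subspace not inside another contains a highest-weight vector outside it -/

/-- **Highest-weight vectors separate stable subspaces.**  For a finite-dimensional rational
representation `ρ` of `GL σ ℂ` and stable subspaces `M ⊄ N`, some highest-weight vector of `ρ` (of some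
weight `χ`) lies in `M` and not in `N`.  Proof: a stable complement `C` of `M ⊓ N` (complete
reducibility, `isSemisimpleRepresentation_of_isRationalRep_holds`); `M ⊓ C ≠ 0` by the modular law;
a highest-weight vector of the non-zero rational module `M ⊓ C` (Lie–Kolchin,
`exists_hasHighestWeight_of_finiteDimensional_holds`) is in `M` and, meeting `N` only in
`M ⊓ N ⊓ C = 0`, not in `N`.  Goodman–Wallach §3.2.1, §4.1.6. [folklore] -/
theorem os_exists_hwv_mem_not_mem {σ : Type} [Fintype σ] [LinearOrder σ]
    {V : Type} [AddCommGroup V] [Module ℂ V] [FiniteDimensional ℂ V]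
    {ρ : Representation ℂ (GL σ ℂ) V} (hρ : IsRationalRep ρ)
    (M N : Subrepresentation ρ) (hMN : ¬ M ≤ N) :
    ∃ (χ : Weight σ) (v : V), v ∈ highestWeightSpace ρ χ ∧ v ∈ M.toSubmodule ∧ v ∉ N.toSubmodule := by
  classical
  have hss : ρ.IsSemisimpleRepresentation := isSemisimpleRepresentation_of_isRationalRep_holds hρ
  obtain ⟨C, hC⟩ := exists_isCompl (M ⊓ N)
  -- the modular law: `M = (M ⊓ N) ⊔ (M ⊓ C)` as submodules, so `M ⊓ C ≠ 0`
  have hsup : (M ⊓ N).toSubmodule ⊔ C.toSubmodule = ⊤ := by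
    have h := congrArg Subrepresentation.toSubmodule hC.sup_eq_top
    rwa [Subrepresentation.toSubmodule_sup] at h
  have hinf : (M ⊓ N).toSubmodule ⊓ C.toSubmodule = ⊥ := by
    have h := congrArg Subrepresentation.toSubmodule hC.inf_eq_bot
    rwa [Subrepresentation.toSubmodule_inf] at h
  have hne : (M ⊓ C).toSubmodule ≠ ⊥ := by
    intro hbot
    apply hMN
    have hmod := sup_inf_assoc_of_le C.toSubmodule
      (show (M ⊓ N).toSubmodule ≤ M.toSubmodule from fun x hx => hx.1)
    rw [hsup, top_inf_eq] at hmod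
    have hMC : C.toSubmodule ⊓ M.toSubmodule = ⊥ := by
      rw [inf_comm]
      exact hbot
    rw [hMC, sup_bot_eq] at hmod
    -- `hmod : M.toSubmodule = (M ⊓ N).toSubmodule`
    intro x hx
    have hx' : x ∈ (M ⊓ N).toSubmodule := hmod ▸ hx
    exact hx'.2
  -- a highest-weight vector of the non-zero rational module `M ⊓ C`
  haveI : Nontrivial ↥(M ⊓ C).toSubmodule := Submodule.nontrivial_iff_ne_bot.mpr hne
  have hrat : IsRationalRep (M ⊓ C).toRepresentation := hρ.toRepresentation (M ⊓ C)
  obtain ⟨χ, hχ⟩ := exists_hasHighestWeight_of_finiteDimensional_holds (M ⊓ C).toRepresentation hrat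
  obtain ⟨x, hx0, hx⟩ := (hasHighestWeight_iff_exists _ χ).mp hχ
  refine ⟨χ, (x : V), (mem_highestWeightSpace_toRepresentation_iff (M ⊓ C) χ x).mp hx, x.2.1, ?_⟩
  intro hxN
  apply hx0
  have hmem : (x : V) ∈ (M ⊓ N).toSubmodule ⊓ C.toSubmodule := ⟨⟨x.2.1, hxN⟩, x.2.2⟩
  rw [hinf, Submodule.mem_bot] at hmem
  exact Subtype.ext hmem

/-! ## 2. Separation by a polynomial ⇒ separation by a highest-weight vector -/

/-- **Outer separation, ideal form.**  If a polynomial `Ψ ∈ ℂ[Sym^m ℂ^σ]` vanishes on `GL · f` but not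
on `GL · g`, then some HIGHEST-WEIGHT vector `F` of `coordRep σ ℂ m` (of some weight `χ`) vanishes on
`GL · f` and not on `GL · g`: run `os_exists_hwv_mem_not_mem` in the finite-dimensional stable
truncation `V₀ = ⊕_{d ≤ deg Ψ} ℂ[Sym^m]_d` (each degree piece is stable, `isHomogeneous_coordSubst`;
rational, `isRationalRep_coordRep`) with the stable subspaces `M = I(GL·f) ∩ V₀`, `N = I(GL·g) ∩ V₀`
(`orbitVanishingIdeal_le_comap_coordSubst`).  BLMW 2011 §4.4; Bläser–Ikenmeyer 2025 §12.4. [folklore] -/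
theorem os_exists_hwv_sep {σ : Type} [Fintype σ] [LinearOrder σ] {m : ℕ}
    (f g : MvPolynomial σ ℂ) (Ψ : MvPolynomial (DegIdx σ m) ℂ)
    (hΨf : Ψ ∈ orbitVanishingIdeal f m) (hΨg : Ψ ∉ orbitVanishingIdeal g m) :
    ∃ (χ : Weight σ) (F : MvPolynomial (DegIdx σ m) ℂ),
      F ∈ highestWeightSpace (coordRep σ ℂ m) χ ∧ F ∈ orbitVanishingIdeal f m ∧
        F ∉ orbitVanishingIdeal g m := by
  classical
  set D := Ψ.totalDegree with hD
  -- the stable truncation `W = ⊕_{d ≤ D} ℂ[Sym^m]_d`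
  let W : Submodule ℂ (MvPolynomial (DegIdx σ m) ℂ) :=
    ⨆ d : Fin (D + 1), homogeneousSubmodule (DegIdx σ m) ℂ (d : ℕ)
  have hWstab : ∀ (g : GL σ ℂ) (v : MvPolynomial (DegIdx σ m) ℂ), v ∈ W → coordRep σ ℂ m g v ∈ W := by
    intro g v hv
    refine Submodule.iSup_induction (p := fun d : Fin (D + 1) => homogeneousSubmodule (DegIdx σ m) ℂ (d : ℕ))
      (motive := fun v => coordRep σ ℂ m g v ∈ W)
      hv (fun d w hw => ?_) (by rw [map_zero]; exact Submodule.zero_mem _)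
      (fun w w' hw hw' => by rw [map_add]; exact Submodule.add_mem _ hw hw')
    refine Submodule.mem_iSup_of_mem d ?_
    rw [mem_homogeneousSubmodule] at hw ⊢
    rw [coordRep_apply]
    exact isHomogeneous_coordSubst g hw
  let V₀ : Subrepresentation (coordRep σ ℂ m) := ⟨W, fun g _ hv => hWstab g _ hv⟩
  haveI : Module.Finite ℂ ↥V₀.toSubmodule := by
    haveI : ∀ d : Fin (D + 1), Module.Finite ℂ ↥(homogeneousSubmodule (DegIdx σ m) ℂ (d : ℕ)) :=
      fun d => finite_homogeneousSubmodule _ _ _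
    change Module.Finite ℂ ↥(⨆ d : Fin (D + 1), homogeneousSubmodule (DegIdx σ m) ℂ (d : ℕ))
    exact Module.Finite.iff_fg.mpr
      (Submodule.fg_iSup _ fun d => Module.Finite.iff_fg.mp (by infer_instance))
  have hΨV₀ : Ψ ∈ V₀.toSubmodule := by
    change Ψ ∈ ⨆ d : Fin (D + 1), homogeneousSubmodule (DegIdx σ m) ℂ (d : ℕ)
    rw [← sum_homogeneousComponent Ψ]
    refine Submodule.sum_mem _ fun i hi => ?_
    have hiD : i < D + 1 := by
      have := Finset.mem_range.mp hi
      omega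
    exact Submodule.mem_iSup_of_mem (⟨i, hiD⟩ : Fin (D + 1)) (homogeneousComponent_mem i Ψ)
  have hρ₀ : IsRationalRep V₀.toRepresentation := (isRationalRep_coordRep m).toRepresentation V₀
  -- the stable subspaces `I(GL·f) ∩ V₀`, `I(GL·g) ∩ V₀` of `V₀`
  let J : MvPolynomial σ ℂ → Subrepresentation V₀.toRepresentation := fun h =>
    ⟨((orbitVanishingIdeal h m).restrictScalars ℂ).comap V₀.toSubmodule.subtype, fun g' x hx => by
      change (coordRep σ ℂ m g' (x : MvPolynomial (DegIdx σ m) ℂ)) ∈ orbitVanishingIdeal h m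
      rw [coordRep_apply]
      exact orbitVanishingIdeal_le_comap_coordSubst h m g' hx⟩
  have hMN : ¬ J f ≤ J g := by
    intro hle
    exact hΨg (hle (x := ⟨Ψ, hΨV₀⟩) hΨf)
  obtain ⟨χ, v, hv, hvM, hvN⟩ := os_exists_hwv_mem_not_mem hρ₀ (J f) (J g) hMN
  exact ⟨χ, (v : MvPolynomial (DegIdx σ m) ℂ), (mem_highestWeightSpace_toRepresentation_iff V₀ χ v).mp hv,
    hvM, hvN⟩

/-- **Outer separation from non-membership.**  For forms `f ≠ 0`, `g` of degree `m` with
`g ∉ Δ_m(f)`, some highest-weight vector of `ℂ[Sym^m]` is an equation of `Δ_m(f)` that does not vanish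
on `GL · g`: by `mem_orbitClosure_iff_formCoeff_holds` some `Ψ ∈ I(GL · f)` has `Ψ(g) ≠ 0`, hence
`Ψ ∉ I(GL · g)` (`g = 1 · g`), and `os_exists_hwv_sep` applies.  Mulmuley–Sohoni 2001 §4;
BLMW 2011 §4.4. [folklore] -/
theorem os_exists_hwv_sep_of_not_mem_orbitClosure {σ : Type} [Fintype σ] [LinearOrder σ] {m : ℕ}
    {f g : MvPolynomial σ ℂ} (hf : f.IsHomogeneous m) (hf0 : f ≠ 0) (hg : g.IsHomogeneous m)
    (h : g ∉ orbitClosure f) :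
    ∃ (χ : Weight σ) (F : MvPolynomial (DegIdx σ m) ℂ),
      F ∈ highestWeightSpace (coordRep σ ℂ m) χ ∧ F ∈ orbitVanishingIdeal f m ∧
        F ∉ orbitVanishingIdeal g m := by
  classical
  have hnot : ¬ (formCoeff m g ∈ MvPolynomial.zeroLocus ℂ (orbitVanishingIdeal f m)) := by
    intro hz
    exact h ((mem_orbitClosure_iff_formCoeff_holds hf hf0).mpr ⟨(mem_homogeneousSubmodule m g).mpr hg, hz⟩)
  rw [MvPolynomial.mem_zeroLocus_iff] at hnot
  push Not at hnot
  obtain ⟨Ψ, hΨf, hΨg⟩ := hnot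
  refine os_exists_hwv_sep f g Ψ hΨf fun hΨ => hΨg ?_
  have h1 := mem_orbitVanishingIdeal_iff.mp hΨ 1
  rwa [map_one, Module.End.one_apply] at h1

/-- **Converse (an outer highest-weight vector — indeed any separating polynomial — certifies
non-membership).**  If `F ∈ I(GL · f)` and `F ∉ I(GL · g)` then `g ∉ Δ_m(f)`: otherwise
`Δ_m(g) ⊆ Δ_m(f)` (`orbitClosure_subset_of_mem_holds`), so `F` would vanish at every `A · g`.
Mulmuley–Sohoni 2001 §4. [folklore] -/
theorem os_not_mem_orbitClosure_of_sep {σ : Type} [Fintype σ] [LinearOrder σ] {m : ℕ}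
    {f g : MvPolynomial σ ℂ} (hf : f.IsHomogeneous m) (hf0 : f ≠ 0)
    {F : MvPolynomial (DegIdx σ m) ℂ} (hFf : F ∈ orbitVanishingIdeal f m)
    (hFg : F ∉ orbitVanishingIdeal g m) : g ∉ orbitClosure f := by
  classical
  intro hmem
  apply hFg
  rw [mem_orbitVanishingIdeal_iff]
  intro A
  have hAg : linSubstRep σ ℂ A g ∈ orbitClosure f :=
    orbitClosure_subset_of_mem_holds hmem (glOrbit_subset_orbitClosure g ⟨A, rfl⟩)
  have hz := ((mem_orbitClosure_iff_formCoeff_holds hf hf0).mp hAg).2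
  rw [MvPolynomial.mem_zeroLocus_iff] at hz
  exact hz F hFf

/-! ## 3. Multiplicity currency -/

/-- The class in `ℂ[Δ_m(f)]` of a highest-weight vector of `ℂ[Sym^m]` is a highest-weight vector of
the same weight (the quotient map is `GL`-equivariant). [folklore] -/
theorem os_mk_mem_highestWeightSpace {σ : Type} [Fintype σ] [LinearOrder σ] (f : MvPolynomial σ ℂ)
    (m : ℕ) {χ : Weight σ} {F : MvPolynomial (DegIdx σ m) ℂ}
    (hF : F ∈ highestWeightSpace (coordRep σ ℂ m) χ) :
    (Ideal.Quotient.mk (orbitVanishingIdeal f m) F : OrbitCoordRing f m) ∈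
      highestWeightSpace (orbitCoordRep f m) χ := by
  intro g hg
  rw [orbitCoordRep_apply, orbitCoordSubst_mk, ← coordRep_apply, hF g hg,
    ← Ideal.Quotient.mkₐ_eq_mk ℂ, map_smul]

/-- **`mult_χ ℂ[Δ_m(f)] + dim (HWV_χ ∩ I(GL · f)) = plethysmCoeff χ`** (`m ≠ 0`): the highest-weight
vectors of the quotient `ℂ[Δ_m(f)]` are the images of those of `ℂ[Sym^m]` (complete reducibility,
`map_highestWeightSpace_eq_of_surjective`) and the kernel of the restricted quotient map is
`HWV_χ ∩ I(GL · f)`.  BLMW 2011 §4.4; Bläser–Ikenmeyer 2025 Prop. 12.7. [folklore] -/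
theorem os_orbitMultiplicity_add_finrank_inf {σ : Type} [Fintype σ] [LinearOrder σ]
    (f : MvPolynomial σ ℂ) {m : ℕ} (hm : m ≠ 0) (χ : Weight σ) :
    orbitMultiplicity ℂ f m χ + Module.finrank ℂ ↥(highestWeightSpace (coordRep σ ℂ m) χ ⊓
        (orbitVanishingIdeal f m).restrictScalars ℂ) = plethysmCoeff ℂ σ m χ := by
  classical
  set HW := highestWeightSpace (coordRep σ ℂ m) χ with hHW
  set I : Submodule ℂ (MvPolynomial (DegIdx σ m) ℂ) := (orbitVanishingIdeal f m).restrictScalars ℂ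
    with hI
  haveI : FiniteDimensional ℂ ↥HW := finiteDimensional_highestWeightSpace_coordRep_holds (k := ℂ) hm χ
  let π : (coordRep σ ℂ m).IntertwiningMap (orbitCoordRep f m) :=
    ⟨(Ideal.Quotient.mkₐ ℂ (orbitVanishingIdeal f m)).toLinearMap, fun _ => LinearMap.ext fun _ => rfl⟩
  have hsurj : Function.Surjective π := Ideal.Quotient.mkₐ_surjective ℂ _
  have hmap := map_highestWeightSpace_eq_of_surjective π hsurj (isSemisimpleRepresentation_coordRep m) χ
  -- the restricted quotient map `HW → HW(ℂ[Δ f])`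
  have hmapsto : ∀ x ∈ HW, π.toLinearMap x ∈ highestWeightSpace (orbitCoordRep f m) χ := by
    intro x hx
    rw [← hmap]
    exact Submodule.mem_map_of_mem hx
  let φ : ↥HW →ₗ[ℂ] ↥(highestWeightSpace (orbitCoordRep f m) χ) := π.toLinearMap.restrict hmapsto
  have hφsurj : Function.Surjective φ := by
    rintro ⟨y, hy⟩
    rw [← hmap] at hy
    obtain ⟨x, hx, rfl⟩ := hy
    exact ⟨⟨x, hx⟩, rfl⟩
  have hker : LinearMap.ker φ = (HW ⊓ I).comap HW.subtype := by
    ext ⟨x, hx⟩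
    simp only [LinearMap.mem_ker, Submodule.mem_comap, Submodule.subtype_apply, Submodule.mem_inf]
    constructor
    · intro h0
      refine ⟨hx, ?_⟩
      have h0' : (π.toLinearMap x : OrbitCoordRing f m) = 0 := congrArg Subtype.val h0
      change (Ideal.Quotient.mkₐ ℂ (orbitVanishingIdeal f m)) x = 0 at h0'
      rw [Ideal.Quotient.mkₐ_eq_mk, Ideal.Quotient.eq_zero_iff_mem] at h0'
      exact h0'
    · rintro ⟨-, hxI⟩
      apply Subtype.ext
      change (Ideal.Quotient.mkₐ ℂ (orbitVanishingIdeal f m)) x = 0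
      rw [Ideal.Quotient.mkₐ_eq_mk, Ideal.Quotient.eq_zero_iff_mem]
      exact hxI
  have hrn := LinearMap.finrank_range_add_finrank_ker φ
  rw [LinearMap.range_eq_top.mpr hφsurj, finrank_top, hker,
    LinearEquiv.finrank_eq (Submodule.comapSubtypeEquivOfLe (inf_le_left : HW ⊓ I ≤ HW))] at hrn
  -- `orbitMultiplicity = finrank HW(ℂ[Δ f])`, `plethysmCoeff = finrank HW`
  exact hrn

/-- **Occurrence on one side, an equation on the other.**  An outer highest-weight vector `F` of weight
`χ` (`F ∈ I(GL · f)`, `F ∉ I(GL · g)`, `m ≠ 0`) gives `1 ≤ mult_χ ℂ[Δ_m(g)]` (its class is a non-zero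
highest-weight vector of `ℂ[Δ_m(g)]`) and `mult_χ ℂ[Δ_m(f)] + 1 ≤ plethysmCoeff χ` (`F` is a non-zero
element of `HWV_χ ∩ I(GL · f)`).  BLMW 2011 §4.4. [folklore] -/
theorem os_occurs_and_equation {σ : Type} [Fintype σ] [LinearOrder σ] {m : ℕ} (hm : m ≠ 0)
    (f g : MvPolynomial σ ℂ) {χ : Weight σ} {F : MvPolynomial (DegIdx σ m) ℂ}
    (hF : F ∈ highestWeightSpace (coordRep σ ℂ m) χ) (hFf : F ∈ orbitVanishingIdeal f m)
    (hFg : F ∉ orbitVanishingIdeal g m) :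
    1 ≤ orbitMultiplicity ℂ g m χ ∧ orbitMultiplicity ℂ f m χ + 1 ≤ plethysmCoeff ℂ σ m χ := by
  classical
  constructor
  · haveI : FiniteDimensional ℂ ↥(highestWeightSpace (orbitCoordRep g m) χ) :=
      finiteDimensional_highestWeightSpace_orbitCoordRep_holds (k := ℂ) g hm χ
    have hne : (Ideal.Quotient.mk (orbitVanishingIdeal g m) F : OrbitCoordRing g m) ≠ 0 := by
      rw [Ne, Ideal.Quotient.eq_zero_iff_mem]
      exact hFg
    have hmem := os_mk_mem_highestWeightSpace g m hF
    change 1 ≤ Module.finrank ℂ ↥(highestWeightSpace (orbitCoordRep g m) χ)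
    rw [Nat.one_le_iff_ne_zero, Ne, Submodule.finrank_eq_zero]
    intro hbot
    rw [hbot, Submodule.mem_bot] at hmem
    exact hne hmem
  · have h := os_orbitMultiplicity_add_finrank_inf f hm χ
    haveI : FiniteDimensional ℂ ↥(highestWeightSpace (coordRep σ ℂ m) χ) :=
      finiteDimensional_highestWeightSpace_coordRep_holds (k := ℂ) hm χ
    have h1 : 1 ≤ Module.finrank ℂ ↥(highestWeightSpace (coordRep σ ℂ m) χ ⊓
        (orbitVanishingIdeal f m).restrictScalars ℂ) := by
      rw [Nat.one_le_iff_ne_zero, Ne, Submodule.finrank_eq_zero]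
      intro hbot
      have hFmem : F ∈ highestWeightSpace (coordRep σ ℂ m) χ ⊓ (orbitVanishingIdeal f m).restrictScalars ℂ :=
        ⟨hF, hFf⟩
      rw [hbot, Submodule.mem_bot] at hFmem
      apply hFg
      rw [hFmem]
      exact Submodule.zero_mem _
    omega

/-- **Non-membership, multiplicity form.**  For forms `f ≠ 0`, `g` of degree `m ≠ 0` with
`g ∉ Δ_m(f)` there is a weight `χ` that OCCURS in `ℂ[Δ_m(g)]` and carries an EQUATION of `Δ_m(f)`:
`1 ≤ mult_χ ℂ[Δ_m(g)]` and `mult_χ ℂ[Δ_m(f)] + 1 ≤ plethysmCoeff χ`.  (This is the weakest — partial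
isotypic — form of a GCT separation; a multiplicity obstruction asks for `mult_χ ℂ[Δ(f)] < mult_χ ℂ[Δ(g)]`.)
BLMW 2011 §1, §4.4; Bläser–Ikenmeyer 2025 §12.4. [folklore] -/
theorem os_exists_weight_occurs_and_equation {σ : Type} [Fintype σ] [LinearOrder σ] {m : ℕ}
    (hm : m ≠ 0) {f g : MvPolynomial σ ℂ} (hf : f.IsHomogeneous m) (hf0 : f ≠ 0)
    (hg : g.IsHomogeneous m) (h : g ∉ orbitClosure f) :
    ∃ χ : Weight σ, 1 ≤ orbitMultiplicity ℂ g m χ ∧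
      orbitMultiplicity ℂ f m χ + 1 ≤ plethysmCoeff ℂ σ m χ := by
  obtain ⟨χ, F, hF, hFf, hFg⟩ := os_exists_hwv_sep_of_not_mem_orbitClosure hf hf0 hg h
  exact ⟨χ, os_occurs_and_equation hm f g hF hFf hFg⟩

/-! ## 4. Flips versus outer highest-weight vectors -/

/-- **A multiplicity flip is an inequality of ideal slices.**  For forms `f, g` of degree `m ≠ 0` and
a weight `χ`: `mult_χ ℂ[Δ_m(f)] < mult_χ ℂ[Δ_m(g)]` iff
`dim (HWV_χ ∩ I(GL · g)) < dim (HWV_χ ∩ I(GL · f))`.  [folklore] -/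
theorem os_lt_iff_finrank_inf_lt {σ : Type} [Fintype σ] [LinearOrder σ] {m : ℕ} (hm : m ≠ 0)
    (f g : MvPolynomial σ ℂ) (χ : Weight σ) :
    orbitMultiplicity ℂ f m χ < orbitMultiplicity ℂ g m χ ↔
      Module.finrank ℂ ↥(highestWeightSpace (coordRep σ ℂ m) χ ⊓ (orbitVanishingIdeal g m).restrictScalars ℂ) <
        Module.finrank ℂ ↥(highestWeightSpace (coordRep σ ℂ m) χ ⊓ (orbitVanishingIdeal f m).restrictScalars ℂ) := by
  have hf := os_orbitMultiplicity_add_finrank_inf f hm χ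
  have hg := os_orbitMultiplicity_add_finrank_inf g hm χ
  omega

/-- **Every flip contains an outer highest-weight vector.**  If `mult_χ ℂ[Δ_m(f)] < mult_χ ℂ[Δ_m(g)]`
(`m ≠ 0`) then some highest-weight vector of weight `χ` is an equation of `Δ_m(f)` not vanishing on
`GL · g`.  [folklore] -/
theorem os_exists_outer_hwv_of_lt {σ : Type} [Fintype σ] [LinearOrder σ] {m : ℕ} (hm : m ≠ 0)
    (f g : MvPolynomial σ ℂ) {χ : Weight σ}
    (hlt : orbitMultiplicity ℂ f m χ < orbitMultiplicity ℂ g m χ) :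
    ∃ F : MvPolynomial (DegIdx σ m) ℂ, F ∈ highestWeightSpace (coordRep σ ℂ m) χ ∧
      F ∈ orbitVanishingIdeal f m ∧ F ∉ orbitVanishingIdeal g m := by
  classical
  rw [os_lt_iff_finrank_inf_lt hm] at hlt
  haveI : FiniteDimensional ℂ ↥(highestWeightSpace (coordRep σ ℂ m) χ) :=
    finiteDimensional_highestWeightSpace_coordRep_holds (k := ℂ) hm χ
  have hnle : ¬ (highestWeightSpace (coordRep σ ℂ m) χ ⊓ (orbitVanishingIdeal f m).restrictScalars ℂ ≤
      highestWeightSpace (coordRep σ ℂ m) χ ⊓ (orbitVanishingIdeal g m).restrictScalars ℂ) := by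
    intro hle
    exact absurd (Submodule.finrank_mono hle) (not_le.mpr hlt)
  obtain ⟨F, hF, hFn⟩ := Set.not_subset.mp hnle
  exact ⟨F, hF.1, hF.2, fun hFg => hFn ⟨hF.1, hFg⟩⟩

/-- **Fullness plus one equation is a flip.**  If the `g` side is FULL at `χ` (`mult_χ ℂ[Δ_m(g)]` equals
the plethysm coefficient, i.e. no highest-weight vector of weight `χ` vanishes on `GL · g`) and `Δ_m(f)`
has an equation of weight `χ` (`mult_χ ℂ[Δ_m(f)] + 1 ≤ plethysmCoeff χ`), then
`mult_χ ℂ[Δ_m(f)] < mult_χ ℂ[Δ_m(g)]`.  [folklore] -/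
theorem os_lt_of_full_of_equation {σ : Type} [Fintype σ] [LinearOrder σ] {m : ℕ}
    (f g : MvPolynomial σ ℂ) {χ : Weight σ}
    (hfull : orbitMultiplicity ℂ g m χ = plethysmCoeff ℂ σ m χ)
    (heq : orbitMultiplicity ℂ f m χ + 1 ≤ plethysmCoeff ℂ σ m χ) :
    orbitMultiplicity ℂ f m χ < orbitMultiplicity ℂ g m χ := by
  omega

end

end Summit.ValiantsHypothesis.ValiantsHypothesis.Theorems.ValuativeFlip
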